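import Literature.Topology.FourManifolds.LefschetzBaseCover
import Literature.Topology.FourManifolds.LefschetzBaseCoverSectors
import Literature.Topology.FourManifolds.LefschetzBaseCoverOverlap
import Literature.AlgebraicTopology.SingularHomology.MayerVietorisBettiOne
import Literature.AlgebraicTopology.SingularHomology.MayerVietorisExactness
import Mathlib.LinearAlgebra.FreeModule.PID
import Mathlib.RingTheory.OrzechProperty
import HarnessLib

/-!
# The standard Lefschetz base of genus `g`, VIII: `H₁(Base g; ℤ)` is free of rank `2g`

Topic `Literature/Topology/FourManifolds`; namespace `Literature.Topology.FourManifolds.LefschetzBase`.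
The rank half of Milnor 1968, Thm. 9.1 for the concrete base (`rank H₁ = μ = 2g`), from the Milnor
cover `Base g = coverU g ∪ coverV g` (`LefschetzBaseCover.lean`: `U ≃ₕ Fin 2`;
`LefschetzBaseCoverSectors.lean`: `V ≃ₕ Fin (2g+1)`; `LefschetzBaseCoverOverlap.lean`:
`U ∩ V ≃ₕ Fin 2 × Fin (2g+1)`) and the end of the Mayer–Vietoris sequence
(`MayerVietorisBettiOne.lean`), plus the linear algebra used to assemble the homology shadow
(`LefschetzBaseShadow.lean`).  Everything here is PROVED; nothing is asserted.

* §11 `pathConnectedSpace_base` — every point of the base is joined inside `U` or `V` (by the two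
  deformations) to a base point `(0, ±1)` or `(ζ_k, 0)`, and these are joined along the radial lifts
  `joined_branchPt_axis`;
* `mayerVietoris_one_free` — the tree's `mayerVietoris_finrank_one` with TORSION-FREENESS recorded (the
  connecting map `∂ : H₁(X) → H₀(U ∩ V) ≅ ℤᶜ` is injective when `H₁(U) = H₁(V) = 0`);
* **`homologyOne_base`** — `H₁(Base g; ℤ)` is finitely generated, free, of rank
  `2(2g+1) − 2 − (2g+1) + 1 = 2g`;
* `chainVec_basis` — the chain vectors `chainVec g i`, `i < 2g`, form a `ℤ`-basis of `ℤ^{Fin g ⊕ Fin g}`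
  (unitriangular: `e_j = v_0 + v_2 + ⋯ + v_{2j}`, `f_j = v_{2j+1}`);
* `bijective_of_dual` — a linear map from a free rank-`n` `ℤ`-module onto `ℤⁿ` hitting the standard
  basis on `n` given elements is bijective (Orzech property of `ℤ`).

## References
* J. Milnor, *Singular points of complex hypersurfaces*, Ann. of Math. Studies 61 (1968), §9,
  Thm. 9.1, Lemma 9.2. [Milnor1968]
* A. Hatcher, *Algebraic Topology*, CUP 2002, §2.2 pp. 149–150. [HatcherAT2002]
-/

noncomputable section

open scoped Manifold ContDiff Topology
open Set Function Metric CategoryTheory CategoryTheory.Limits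
open Literature.AlgebraicTopology.SingularHomology Literature.Topology.FourManifolds.TorusKnotMilnor

universe u

namespace Literature.Topology.FourManifolds

namespace LefschetzBase

variable {g : ℕ}

/-! ## §11 The base is path connected -/

/-- **The standard Lefschetz base `Base g` is path connected.** [cite: Milnor1968, §9 Lemma 9.2] -/
instance pathConnectedSpace_base (g : ℕ) : PathConnectedSpace (Base g) := by
  let b : Fin 2 → Base g := fun j => (secU g j).1
  have hVU : ∀ (k : Fin (2 * g + 1)) (j : Fin 2), Joined (secV g k).1 (b j) := fun k j =>
    joined_branchPt_axis g (basePtV_pow g k) (by rw [norm_mul, norm_halfRoot, norm_pow, norm_rootU, one_pow, mul_one])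
      (rootU_pow_pow two_ne_zero j) _ _
  have hUU : ∀ j : Fin 2, Joined (b j) (b 0) := fun j =>
    (hVU ⟨0, Nat.succ_pos _⟩ j).symm.trans (hVU ⟨0, Nat.succ_pos _⟩ 0)
  have key : ∀ p : Base g, Joined p (b 0) := by
    intro p
    rcases (show p ∈ coverU g ∪ coverV g by rw [coverU_union_coverV]; trivial) with hp | hp
    · have h1 : Joined (⟨p, hp⟩ : ↥(coverU g)) (secU g (idxU ⟨p, hp⟩)) :=
        joined_of_homotopy_id (homotopyU g) ⟨p, hp⟩
      exact (joined_val_of_joined h1).trans (hUU _)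
    · have h1 : Joined (⟨p, hp⟩ : ↥(coverV g)) (secV g (idxV ⟨p, hp⟩)) :=
        joined_of_homotopy_id (homotopyV g) ⟨p, hp⟩
      exact (joined_val_of_joined h1).trans (hVU _ 0)
  exact ⟨⟨b 0⟩, fun x y => (key x).trans (key y).symm⟩

/-! ## Mayer–Vietoris: `H₁(Base g; ℤ)` is free of rank `2g` -/

/-- **The end of the Mayer–Vietoris sequence with homologically discrete pieces, with freeness.**
For an open cover `X = U ∪ V` of a path-connected space with `H₁(U) = H₁(V) = 0`, `H₀(U) ≅ ℤᵃ`,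
`H₀(V) ≅ ℤᵇ`, `H₀(U ∩ V) ≅ ℤᶜ`: `H₁(X; ℤ)` is finitely generated, TORSION FREE (the connecting map
`∂ : H₁(X) → H₀(U ∩ V) ≅ ℤᶜ` is injective since `H₁(U) ⊕ H₁(V) = 0`), and
`rank H₁(X) + a + b = c + 1` (the tree's `mayerVietoris_finrank_one`). [cite: HatcherAT2002, §2.2 pp. 149–150] -/
theorem mayerVietoris_one_free {X : Type u} [TopologicalSpace X] [PathConnectedSpace X] (U V : Set X)
    (hU : IsOpen U) (hV : IsOpen V) (hUV : U ∪ V = univ)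
    (hU₁ : IsZero (singularHomology ℤ ℤ U 1)) (hV₁ : IsZero (singularHomology ℤ ℤ V 1))
    {a b c : ℕ} (eU : singularHomology ℤ ℤ U 0 ≃ₗ[ℤ] (Fin a → ℤ))
    (eV : singularHomology ℤ ℤ V 0 ≃ₗ[ℤ] (Fin b → ℤ))
    (eW : singularHomology ℤ ℤ ↥(U ∩ V) 0 ≃ₗ[ℤ] (Fin c → ℤ)) :
    Module.Finite ℤ (singularHomology ℤ ℤ X 1) ∧ Module.IsTorsionFree ℤ (singularHomology ℤ ℤ X 1) ∧
      Module.finrank ℤ (singularHomology ℤ ℤ X 1) + (a + b) = c + 1 := by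
  obtain ⟨hrk, hfin⟩ := mayerVietoris_finrank_one U V hU hV hUV hU₁ hV₁ eU eV eW
  have h : interior U ∪ interior V = univ := by rw [hU.interior_eq, hV.interior_eq, hUV]
  have hexc := relativeSingularHomology.isIso_map_of_interior_union_interior_holds ℤ ℤ X
  have hψ₁ : mayerVietoris.ψ ℤ ℤ U V 1 = 0 := biprod_desc_eq_zero_of_isZero hU₁ hV₁ _
  have hmono : Mono (mayerVietoris.δ ℤ ℤ U V hexc h 0) :=
    (mayerVietoris.exact₂_holds ℤ ℤ U V hexc h 0).mono_g hψ₁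
  have hinj : Injective (mayerVietoris.δ ℤ ℤ U V hexc h 0).hom := (ModuleCat.mono_iff_injective _).1 hmono
  have htf : Module.IsTorsionFree ℤ (singularHomology ℤ ℤ X 1) :=
    Function.Injective.moduleIsTorsionFree (f := ⇑(eW.toLinearMap ∘ₗ (mayerVietoris.δ ℤ ℤ U V hexc h 0).hom))
      (eW.injective.comp hinj) fun r m => (eW.toLinearMap ∘ₗ (mayerVietoris.δ ℤ ℤ U V hexc h 0).hom).map_smul r m
  exact ⟨hfin, htf, hrk⟩

/-- **`H₁(Base g; ℤ)` is finitely generated and free of rank `2g`** (Milnor 1968, Thm. 9.1: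
`rank = μ = (2 − 1)(2g + 1 − 1)`), from the Milnor cover: `rank H₁ + 2 + (2g+1) = 2(2g+1) + 1`.
[cite: Milnor1968, Thm. 9.1] -/
theorem homologyOne_base (g : ℕ) :
    Module.Finite ℤ (singularHomology ℤ ℤ (Base g) 1) ∧ Module.Free ℤ (singularHomology ℤ ℤ (Base g) 1) ∧
      Module.finrank ℤ (singularHomology ℤ ℤ (Base g) 1) = 2 * g := by
  have hU : ContinuousMap.HomotopyEquiv ↥(coverU g) (Fin 2) := homotopyEquivU g
  have hV : ContinuousMap.HomotopyEquiv ↥(coverV g) (Fin (2 * g + 1)) := homotopyEquivV g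
  have hW : ContinuousMap.HomotopyEquiv ↥(coverU g ∩ coverV g) (Fin 2 × Fin (2 * g + 1)) := homotopyEquivW g
  obtain ⟨e₂⟩ := singularHomology.nonempty_zeroLinearEquivFin_of_ne_zero ℤ ℤ (two_ne_zero)
  obtain ⟨e₃⟩ := singularHomology.nonempty_zeroLinearEquivFin_of_ne_zero ℤ ℤ (Nat.succ_ne_zero (2 * g))
  obtain ⟨e₆⟩ := singularHomology.nonempty_zeroLinearEquivFin_of_ne_zero ℤ ℤ
    (mul_ne_zero two_ne_zero (Nat.succ_ne_zero (2 * g)))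
  have eU : singularHomology ℤ ℤ ↥(coverU g) 0 ≃ₗ[ℤ] (Fin 2 → ℤ) :=
    (singularHomology.isoOfHomotopyEquiv ℤ ℤ hU 0).toLinearEquiv ≪≫ₗ e₂
  have eV : singularHomology ℤ ℤ ↥(coverV g) 0 ≃ₗ[ℤ] (Fin (2 * g + 1) → ℤ) :=
    (singularHomology.isoOfHomotopyEquiv ℤ ℤ hV 0).toLinearEquiv ≪≫ₗ e₃
  have eW : singularHomology ℤ ℤ ↥(coverU g ∩ coverV g) 0 ≃ₗ[ℤ] (Fin (2 * (2 * g + 1)) → ℤ) :=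
    (singularHomology.isoOfHomotopyEquiv ℤ ℤ hW 0).toLinearEquiv ≪≫ₗ
      (singularHomology.mapIso ℤ ℤ (finProdHomeomorph 2 (2 * g + 1)) 0).toLinearEquiv ≪≫ₗ e₆
  have hU₁ : IsZero (singularHomology ℤ ℤ ↥(coverU g) 1) :=
    (singularHomology.isZero_fin ℤ ℤ 2 one_ne_zero).of_iso (singularHomology.isoOfHomotopyEquiv ℤ ℤ hU 1)
  have hV₁ : IsZero (singularHomology ℤ ℤ ↥(coverV g) 1) :=
    (singularHomology.isZero_fin ℤ ℤ (2 * g + 1) one_ne_zero).of_iso (singularHomology.isoOfHomotopyEquiv ℤ ℤ hV 1)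
  obtain ⟨hfin, htf, hrk⟩ := mayerVietoris_one_free (coverU g) (coverV g) (isOpen_coverU g) (isOpen_coverV g)
    (coverU_union_coverV g) hU₁ hV₁ eU eV eW
  haveI := hfin
  haveI := htf
  exact ⟨hfin, Module.free_of_finite_type_torsion_free', by omega⟩

/-! ## The chain vectors are a basis of `ℤ^{2g}` -/

/-- The even chain vectors: `v_{2j} = e_j − e_{j−1}` (`e_{−1} = 0`). [folklore] -/
theorem chainVec_even (g : ℕ) (j : Fin g) :
    chainVec g (2 * j) = Pi.single (Sum.inl j) 1 -
      (if 0 < (j : ℕ) then Pi.single (Sum.inl ⟨(j : ℕ) - 1, by omega⟩) 1 else 0) := by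
  have h1 : 2 * (j : ℕ) / 2 = j := by omega
  have h2 : 2 * (j : ℕ) % 2 = 0 := by omega
  unfold chainVec
  rw [dif_pos (by rw [h1]; exact j.2), if_pos h2]
  congr 1
  · congr 2; exact Fin.ext h1
  · simp only [h1]

/-- The odd chain vectors: `v_{2j+1} = f_j`. [folklore] -/
theorem chainVec_odd (g : ℕ) (j : Fin g) : chainVec g (2 * j + 1) = Pi.single (Sum.inr j) 1 := by
  have h1 : (2 * (j : ℕ) + 1) / 2 = j := by omega
  have h2 : (2 * (j : ℕ) + 1) % 2 = 1 := by omega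
  unfold chainVec
  rw [dif_pos (by rw [h1]; exact j.2), if_neg (by rw [h2]; exact one_ne_zero)]
  congr 2; exact Fin.ext h1

/-- Every standard basis vector lies in the span of the chain vectors `v_i`, `i < 2g`
(`e_j = v_0 + v_2 + ⋯ + v_{2j}`, `f_j = v_{2j+1}`). [folklore] -/
theorem single_mem_span_chainVec (g : ℕ) (s : Fin g ⊕ Fin g) :
    (Pi.single s 1 : Fin g ⊕ Fin g → ℤ) ∈ Submodule.span ℤ (Set.range fun i : Fin (2 * g) => chainVec g i) := by
  set S := Submodule.span ℤ (Set.range fun i : Fin (2 * g) => chainVec g i) with hS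
  have hmem : ∀ i : ℕ, i < 2 * g → chainVec g i ∈ S := fun i hi =>
    Submodule.subset_span ⟨⟨i, hi⟩, rfl⟩
  have hinl : ∀ n : ℕ, ∀ h : n < g, (Pi.single (Sum.inl ⟨n, h⟩) 1 : Fin g ⊕ Fin g → ℤ) ∈ S := by
    intro n
    induction n with
    | zero =>
      intro h
      have := hmem 0 (by omega)
      rw [show (0 : ℕ) = 2 * ((⟨0, h⟩ : Fin g) : ℕ) from rfl, chainVec_even] at this
      simpa using this
    | succ n ih =>
      intro h
      have h1 := hmem (2 * (n + 1)) (by omega)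
      rw [show 2 * (n + 1) = 2 * ((⟨n + 1, h⟩ : Fin g) : ℕ) from rfl, chainVec_even] at h1
      simp only [Nat.succ_pos', if_true, Nat.add_sub_cancel] at h1
      have h2 := ih (by omega)
      have h3 := S.add_mem h1 h2
      rwa [sub_add_cancel] at h3
  rcases s with j | j
  · exact hinl j j.2
  · have := hmem (2 * j + 1) (by omega)
    rwa [chainVec_odd] at this

/-- **the chain vectors `chainVec g i`, `i < 2g`, form a `ℤ`-basis of
`ℤ^{Fin g ⊕ Fin g}`** (they span, and `2g` spanning vectors of a free module of rank `2g` over a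
commutative ring are a basis). [folklore] -/
theorem chainVec_basis (g : ℕ) :
    ∃ b : Module.Basis (Fin (2 * g)) ℤ (Fin g ⊕ Fin g → ℤ), ∀ i, b i = chainVec g i := by
  have htop : ⊤ ≤ Submodule.span ℤ (Set.range fun i : Fin (2 * g) => chainVec g i) := by
    rw [← (Pi.basisFun ℤ (Fin g ⊕ Fin g)).span_eq, Submodule.span_le]
    rintro _ ⟨s, rfl⟩
    rw [Pi.basisFun_apply]
    exact single_mem_span_chainVec g s
  have hcard : Fintype.card (Fin (2 * g)) = Module.finrank ℤ (Fin g ⊕ Fin g → ℤ) := by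
    rw [Module.finrank_fintype_fun_eq_card, Fintype.card_sum, Fintype.card_fin, Fintype.card_fin]; ring
  exact ⟨basisOfTopLeSpanOfCardEqFinrank _ htop hcard, fun i => by
    rw [coe_basisOfTopLeSpanOfCardEqFinrank]⟩

/-! ## Linear algebra of the assembly -/


/-- **Algebra of the assembly.**  A free `ℤ`-module `H` of rank `n` with elements `c_i` and a
linear map `Ψ : H → ℤⁿ` with `Ψ c_i = e_i` is mapped by `Ψ` ISOMORPHICALLY: `Ψ` is onto, and an
epimorphism between free modules of the same finite rank is injective (Orzech property).
[folklore] -/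
theorem bijective_of_dual {H : Type*} [AddCommGroup H] [Module ℤ H] [Module.Finite ℤ H] [Module.Free ℤ H]
    {n : ℕ} (hrk : Module.finrank ℤ H = n) (c : Fin n → H) (Ψ : H →ₗ[ℤ] (Fin n → ℤ))
    (hΨ : ∀ i, Ψ (c i) = Pi.single i 1) : Function.Bijective Ψ := by
  have hsurj : Function.Surjective Ψ := by
    rw [← LinearMap.range_eq_top, eq_top_iff, ← (Pi.basisFun ℤ (Fin n)).span_eq, Submodule.span_le]
    rintro _ ⟨i, rfl⟩
    exact ⟨c i, by rw [hΨ, Pi.basisFun_apply]⟩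
  refine ⟨?_, hsurj⟩
  let e : (Fin n → ℤ) ≃ₗ[ℤ] H := (Module.finBasisOfFinrankEq ℤ H hrk).equivFun.symm
  have hs : Function.Surjective (Ψ ∘ₗ e.toLinearMap) := hsurj.comp e.surjective
  have hi := OrzechProperty.injective_of_surjective_endomorphism _ hs
  intro x y hxy
  have h := @hi (e.symm x) (e.symm y) (by simp [hxy])
  simpa using h

end LefschetzBase

end Literature.Topology.FourManifolds
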